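import Mathlib.Analysis.SpecialFunctions.Log.Basic
import Literature.IUT.HodgeArakelov.GoodPrimeKummerBridgeArch
import Literature.IUT.HodgeArakelov.ConstantMonoidRealification
import Literature.IUT.HodgeArakelov.HodgeTheaterKitBridge
import HarnessLib

/-!
# [IUTchII] Prop 4.3 (ii) / Prop 4.4 (ii), realified part, at archimedean primes:
# `Ψ_cns(U_v)/Ψ_cns(U_v)^× ⥲ R_{≥0}(U_v)` CONSTRUCTED and the unique normalised isomorphism
# `Ψ^R_{†F^⊢_v} ⥲ R_{≥0}(†D^⊢_v)` PROVED

S. Mochizuki, *Inter-universal Teichmüller theory II*, §4, kurims manuscript (Dec. 2020), Proposition 4.3 (ii)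
p. 127 and Proposition 4.4 (ii) pp. 129–130 (`v ∈ V^arc`), read on the page (lit key `paper:url-5036b4059555`,
pp. 127–131) [cite: Mochizuki2012, Prop 4.4 (ii) p.130]. Claim key DISPUTED (D-0012). Printed proofs: "The
various assertions of Proposition 4.3 [resp. 4.4] follow immediately from the definitions and the references
quoted in the statements of these assertions." (pp. 129, 131).

WHAT IS PRINTED. Prop 4.3 (ii) p. 127: "a topological monoid `R_{≥0}(D^⊢_v)` equipped with a distinguished
element `log^{D^⊢_v}(p_v) ∈ R_{≥0}(D^⊢_v)` … Finally, there is a functorial algorithm in the Aut-holomorphic space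
`U_v` for constructing the natural isomorphism [which arises immediately from the definitions]
`Ψ^R_cns(U_v) := Ψ_cns(U_v)/Ψ_cns(U_v)^× ⥲ R_{≥0}(U_v)`", where `Ψ_cns(U_v) := A^▷_{U_v}` is "the topological monoid of
nonzero elements of absolute value `≤ 1` of the complex archimedean field" (p. 127). Prop 4.4 (ii) pp. 129–130:
"Write `Ψ_{†F^⊢_v} := 𝒪^▷(†C^⊢_v)` … there exists … a unique isomorphism of monoids
`Ψ^R_{†F^⊢_v} := Ψ_{†F^⊢_v}/Ψ^×_{†F^⊢_v} ⥲ Ψ^R_cns(†D^⊢_v) := R_{≥0}(†D^⊢_v)` that maps the distinguished element of `Ψ^R_{†F^⊢_v}`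
determined by `p_v = e = 2.71828…` [i.e., the element of the complex archimedean field that gives rise to
`Ψ_{†F_v}` whose natural logarithm is equal to `1`] to the distinguished element of `Ψ^R_cns(†D^⊢_v)` determined
by `log^{†D^⊢_v}(p_v) ∈ R_{≥0}(†D^⊢_v)`".

WHAT THE TREE HAD. abc-iut-L6-t2 records `R_{≥0}(−)` AS `ℝ≥0` with its distinguished element (`LogRealDatum`;
at archimedean `v`, `LogRealDatum.arch`, `log(p_v) = 1` since `p_v = e`, `HodgeTheaterKitBridge.lean`), the
abstract uniqueness "additive automorphisms of `ℝ≥0` fixing a nonzero element are trivial"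
(`PointedHalfLine.isoUnique_holds`, `PsiRlf.mulEquiv_nnreal_eq_refl`) and, at NONarchimedean `v`, the realified
isomorphism `(Ψ/Ψ^×)^rlf ⥲ ℝ_{≥0}` (`PsiRlf.existsUnique_iso`, for `Ψ/Ψ^× ≅ ℚ_{≥0}`). At ARCHIMEDEAN `v` the quotient
`Ψ/Ψ^×` of the closed unit-disc monoid `𝒪^▷_A` (abc-iut-L5-t2's `unitDiscMonoid`) is already a copy of `ℝ_{≥0}`
(no realification: print writes `Ψ/Ψ^×`, not `(Ψ/Ψ^×)^rlf`), and its identification with `R_{≥0}(U_v) = ℝ≥0` was not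
in the tree. THIS FILE constructs it and proves the printed uniqueness:

* `negLogNorm : 𝒪^▷_A →* ℝ_{≥0}`, `z ↦ −log ‖z‖` (multiplicative-to-additive); its fibres are EXACTLY the classes
  modulo units (`associated_iff_norm_eq`, using p416766's `(𝒪^▷_A)^× = {‖z‖ = 1}`), and it is onto for a normed
  `ℝ`-algebra (`negLogNorm_surjective`: `‖r·1‖ = r`);
* **Prop 4.3 (ii) CONSTRUCTED**: `archRealifiedIso A : Associates (𝒪^▷_A) ≃* ℝ_{≥0}` — the "natural isomorphism
  `Ψ^R_cns(U_v) := Ψ_cns(U_v)/Ψ_cns(U_v)^× ⥲ R_{≥0}(U_v)`" (Mathlib's `Associates M = M/M^×`); it carries the class of the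
  elements of norm `e⁻¹ = |p_v|⁻¹` — the divisor of `p_v = e` in the effective normalisation `f ↦ −log ‖f‖` of
  `𝒪^▷ ⊆ 𝒪^▷/𝒪^×` — to `1 = log^{D^⊢_v}(p_v)` (`archRealifiedIso_distinguished`);
* **Prop 4.4 (ii), realified part, PROVED** for every instance `X` of the [IUTchI] Ex 3.4 interface
  (`ArchLocalFrobenioid`, `Ψ_{†F^⊢_v} = 𝒪^▷(†C^⊢_v) = X.OC`): there is EXACTLY ONE isomorphism of monoids
  `Ψ_{†F^⊢_v}/Ψ^×_{†F^⊢_v} ⥲ R_{≥0}(†D^⊢_v) = ℝ_{≥0}` carrying the distinguished class (`archDistinguished X`, the class of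
  the elements of `𝒪^▷(†C_v)` of absolute value `e⁻¹` under `𝒪^▷(C_v) ⥲ 𝒪^▷_{K_v}`) to `log^{†D^⊢_v}(p_v) = 1`
  (`existsUnique_realifiedIso`; the isomorphism is `realifiedIsoArch X`).

HONEST FRAMING. Elementary real analysis (`log`, `exp`) over the cell's own normalisations
(`R_{≥0}(−) := ℝ≥0`, `log(p_v) := 1` at `v ∈ V^arc`); the SIGN/normalisation reading "the class of norm-`e⁻¹`
elements ↦ `log(p_v)`" of the printed "`p_v = e`" is recorded here explicitly and is the only interpretive step.
Nothing here bears on [IUTchIII] Cor. 3.12 or takes a side; typed ≠ discharged elsewhere.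
-/

noncomputable section

open scoped _root_.NNReal

namespace Literature.IUT.HodgeArakelov

open Literature.IUT.HodgeTheaters

universe u

namespace GoodPrimeKummer

/-! ### 1. `−log ‖·‖` on the closed unit-disc monoid -/

section NegLogNorm

variable {A : Type*} [NormedField A]

/-- `−log ‖z‖ ≥ 0` for `z` in the closed unit disc, as an element of `ℝ_{≥0}` ([IUTchII] Prop 4.3 (ii) p. 127: the
value in `R_{≥0}(U_v)` of the class of `z`). [cite: Mochizuki2012, Prop 4.3 (ii) p.127] -/
def nlogNorm (z : unitDiscMonoid A) : ℝ≥0 :=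
  ⟨-Real.log ‖(z : A)‖, neg_nonneg.2 (Real.log_nonpos (norm_nonneg _) z.2.2)⟩

/-- `nlogNorm z`, read in `ℝ`, is `−log ‖z‖`. [cite: Mochizuki2012, Prop 4.3 (ii) p.127] -/
@[simp] theorem coe_nlogNorm (z : unitDiscMonoid A) : (nlogNorm z : ℝ) = -Real.log ‖(z : A)‖ := rfl

/-- `z ↦ −log ‖z‖`, the monoid homomorphism `𝒪^▷_A → ℝ_{≥0}` (target written multiplicatively) — the effective
"order/degree" normalisation under which `Ψ/Ψ^×` becomes `R_{≥0}` ([IUTchII] Prop 4.3 (ii) p. 127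
"`Ψ^R_cns(U_v) := Ψ_cns(U_v)/Ψ_cns(U_v)^× ⥲ R_{≥0}(U_v)`"). [cite: Mochizuki2012, Prop 4.3 (ii) p.127] -/
def negLogNorm : unitDiscMonoid A →* Multiplicative ℝ≥0 where
  toFun z := Multiplicative.ofAdd (nlogNorm z)
  map_one' := by
    rw [← ofAdd_zero]
    congr 1
    apply NNReal.eq
    rw [coe_nlogNorm, OneMemClass.coe_one, norm_one, Real.log_one, neg_zero, NNReal.coe_zero]
  map_mul' z w := by
    rw [← ofAdd_add]
    congr 1
    apply NNReal.eq
    rw [NNReal.coe_add, coe_nlogNorm, coe_nlogNorm, coe_nlogNorm, Submonoid.coe_mul, norm_mul,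
      Real.log_mul (norm_ne_zero_iff.2 z.2.1) (norm_ne_zero_iff.2 w.2.1), neg_add]

/-- The value of `negLogNorm`, read in `ℝ`. [cite: Mochizuki2012, Prop 4.3 (ii) p.127] -/
@[simp] theorem coe_toAdd_negLogNorm (z : unitDiscMonoid A) :
    ((Multiplicative.toAdd (negLogNorm z) : ℝ≥0) : ℝ) = -Real.log ‖(z : A)‖ := rfl

/-- `negLogNorm` separates exactly the norms: `−log ‖z‖ = −log ‖w‖ ⟺ ‖z‖ = ‖w‖` (`log` is injective on the
positive reals). [cite: Mochizuki2012, Prop 4.3 (ii) p.127] -/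
theorem negLogNorm_eq_iff {z w : unitDiscMonoid A} : negLogNorm z = negLogNorm w ↔ ‖(z : A)‖ = ‖(w : A)‖ := by
  constructor
  · intro h
    have h1 := congrArg (fun x => ((Multiplicative.toAdd x : ℝ≥0) : ℝ)) h
    simp only [coe_toAdd_negLogNorm, neg_inj] at h1
    exact Real.log_injOn_pos (Set.mem_Ioi.2 (norm_pos_iff.2 z.2.1)) (Set.mem_Ioi.2 (norm_pos_iff.2 w.2.1)) h1
  · intro h
    apply Multiplicative.toAdd.injective
    apply NNReal.eq
    simp only [coe_toAdd_negLogNorm, h]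

/-- **The classes of `𝒪^▷_A` modulo units are the level sets of the norm**: `z ~ᵤ w ⟺ ‖z‖ = ‖w‖` (units have
norm `1`, p416766's `norm_eq_one_of_isUnit`; conversely `w/z` has norm `1`, hence is a unit of `𝒪^▷_A`,
`isUnit_of_norm_eq_one`). [cite: Mochizuki2012, Prop 4.3 (ii) p.127] -/
theorem associated_iff_norm_eq {z w : unitDiscMonoid A} : Associated z w ↔ ‖(z : A)‖ = ‖(w : A)‖ := by
  constructor
  · rintro ⟨u, rfl⟩
    rw [Submonoid.coe_mul, norm_mul, norm_eq_one_of_isUnit u.isUnit, mul_one]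
  · intro h
    have hz : (z : A) ≠ 0 := z.2.1
    have hu1 : ‖(w : A) / (z : A)‖ = 1 := by
      rw [norm_div, ← h, div_self (norm_ne_zero_iff.2 hz)]
    obtain ⟨u, hu⟩ := isUnit_of_norm_eq_one
      (z := (⟨(w : A) / (z : A), div_ne_zero w.2.1 hz, hu1.le⟩ : unitDiscMonoid A)) hu1
    refine ⟨u, Subtype.ext ?_⟩
    rw [Submonoid.coe_mul, hu]
    change (z : A) * ((w : A) / (z : A)) = w
    rw [mul_comm]
    exact div_mul_cancel₀ (w : A) hz

/-- Units have `−log ‖u‖ = 0`. [cite: Mochizuki2012, Prop 4.3 (ii) p.127] -/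
theorem negLogNorm_eq_one_of_isUnit {z : unitDiscMonoid A} (hz : IsUnit z) : negLogNorm z = 1 := by
  rw [← map_one (negLogNorm (A := A))]
  exact negLogNorm_eq_iff.2 (by rw [norm_eq_one_of_isUnit hz, OneMemClass.coe_one, norm_one])

variable [NormedAlgebra ℝ A]

/-- For a normed `ℝ`-algebra `A`, `negLogNorm` is ONTO `ℝ_{≥0}`: `r ↦ e^{-r}·1 ∈ 𝒪^▷_A` has `−log ‖e^{-r}·1‖ = r`.
[cite: Mochizuki2012, Prop 4.3 (ii) p.127] -/
theorem negLogNorm_surjective : Function.Surjective (negLogNorm (A := A)) := by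
  intro r
  have hpos : 0 < Real.exp (-((Multiplicative.toAdd r : ℝ≥0) : ℝ)) := Real.exp_pos _
  have hnorm : ‖algebraMap ℝ A (Real.exp (-((Multiplicative.toAdd r : ℝ≥0) : ℝ)))‖ =
      Real.exp (-((Multiplicative.toAdd r : ℝ≥0) : ℝ)) := by
    rw [norm_algebraMap' A, Real.norm_eq_abs, abs_of_pos hpos]
  refine ⟨⟨algebraMap ℝ A (Real.exp (-((Multiplicative.toAdd r : ℝ≥0) : ℝ))), ?_, ?_⟩, ?_⟩
  · exact norm_pos_iff.1 (by rw [hnorm]; exact hpos)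
  · rw [hnorm, Real.exp_le_one_iff, neg_nonpos]
    exact (Multiplicative.toAdd r).2
  · apply Multiplicative.toAdd.injective
    apply NNReal.eq
    rw [coe_toAdd_negLogNorm]
    change -Real.log ‖algebraMap ℝ A (Real.exp (-((Multiplicative.toAdd r : ℝ≥0) : ℝ)))‖ = _
    rw [hnorm, Real.log_exp, neg_neg]

end NegLogNorm

/-! ### 2. Prop 4.3 (ii): `Ψ_cns(U_v)/Ψ_cns(U_v)^× ⥲ R_{≥0}(U_v)` -/

section Realified

variable {A : Type*} [NormedField A]

/-- `Ψ/Ψ^× → R_{≥0}`: `negLogNorm` descended to the quotient modulo units (Mathlib's `Associates`), i.e. the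
class of `z` ↦ `−log ‖z‖`. [cite: Mochizuki2012, Prop 4.3 (ii) p.127] -/
def assocNegLogNorm : Associates (unitDiscMonoid A) →* Multiplicative ℝ≥0 where
  toFun := Quotient.lift (negLogNorm (A := A)) fun _ _ h => negLogNorm_eq_iff.2 (associated_iff_norm_eq.1 h)
  map_one' := by
    rw [Associates.one_eq_mk_one]
    exact map_one (negLogNorm (A := A))
  map_mul' x y := by
    refine Quotient.inductionOn₂ x y fun a b => ?_
    change negLogNorm (a * b) = negLogNorm a * negLogNorm b
    exact map_mul negLogNorm a b

/-- On a class `[z]`, `assocNegLogNorm` is `−log ‖z‖`. [cite: Mochizuki2012, Prop 4.3 (ii) p.127] -/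
@[simp] theorem assocNegLogNorm_mk (z : unitDiscMonoid A) :
    assocNegLogNorm (Associates.mk z) = negLogNorm z := rfl

/-- `assocNegLogNorm` is injective: classes with the same `−log ‖·‖` have the same norm, hence are equal.
[cite: Mochizuki2012, Prop 4.3 (ii) p.127] -/
theorem assocNegLogNorm_injective : Function.Injective (assocNegLogNorm (A := A)) := by
  intro x y
  refine Quotient.inductionOn₂ x y fun a b h => ?_
  change negLogNorm a = negLogNorm b at h
  exact Associates.mk_eq_mk_iff_associated.2 (associated_iff_norm_eq.2 (negLogNorm_eq_iff.1 h))

variable [NormedAlgebra ℝ A]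

variable (A) in
/-- **[IUTchII] Prop 4.3 (ii) CONSTRUCTED** (p. 127: "the natural isomorphism [which arises immediately from the
definitions] `Ψ^R_cns(U_v) := Ψ_cns(U_v)/Ψ_cns(U_v)^× ⥲ R_{≥0}(U_v)`"), for `Ψ_cns(U_v) = A^▷_{U_v} = 𝒪^▷_A` the closed
unit-disc monoid of a complex archimedean field (any normed field that is a normed `ℝ`-algebra) and
`R_{≥0}(U_v) = ℝ_{≥0}` (abc-iut-L6-t2's normalisation `LogRealDatum.arch`): the class of `z` ↦ `−log ‖z‖`, an
ISOMORPHISM of monoids. [cite: Mochizuki2012, Prop 4.3 (ii) p.127] -/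
def archRealifiedIso : Associates (unitDiscMonoid A) ≃* Multiplicative ℝ≥0 :=
  MulEquiv.ofBijective (assocNegLogNorm (A := A))
    ⟨assocNegLogNorm_injective, fun r => by
      obtain ⟨z, hz⟩ := negLogNorm_surjective (A := A) r
      exact ⟨Associates.mk z, hz⟩⟩

/-- On a class `[z]` the isomorphism of Prop 4.3 (ii) is `−log ‖z‖`. [cite: Mochizuki2012, Prop 4.3 (ii) p.127] -/
@[simp] theorem archRealifiedIso_mk (z : unitDiscMonoid A) :
    archRealifiedIso A (Associates.mk z) = negLogNorm z := rfl

/-- … read in `ℝ`. [cite: Mochizuki2012, Prop 4.3 (ii) p.127] -/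
theorem coe_toAdd_archRealifiedIso_mk (z : unitDiscMonoid A) :
    ((Multiplicative.toAdd (archRealifiedIso A (Associates.mk z)) : ℝ≥0) : ℝ) = -Real.log ‖(z : A)‖ := rfl

variable (A) in
/-- The element `e⁻¹·1 ∈ 𝒪^▷_A` (absolute value `e⁻¹ = |p_v|⁻¹`, `p_v = e`): a representative of "the distinguished
element of `Ψ^R` determined by `p_v = e = 2.71828…`" ([IUTchII] Prop 4.4 (ii) p. 130) in the effective
normalisation `f ↦ −log ‖f‖` of `𝒪^▷ → 𝒪^▷/𝒪^× ≅ R_{≥0}` (the class of norm `e⁻¹` is the one of "logarithm `1`").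
[cite: Mochizuki2012, Prop 4.4 (ii) p.130] -/
def expNegOne : unitDiscMonoid A :=
  ⟨algebraMap ℝ A (Real.exp (-1)),
    norm_pos_iff.1 (by rw [norm_algebraMap' A, Real.norm_eq_abs, abs_of_pos (Real.exp_pos _)]; exact Real.exp_pos _),
    by rw [norm_algebraMap' A, Real.norm_eq_abs, abs_of_pos (Real.exp_pos _), Real.exp_le_one_iff]; norm_num⟩

/-- `‖e⁻¹·1‖ = e⁻¹`. [cite: Mochizuki2012, Prop 4.4 (ii) p.130] -/
theorem norm_expNegOne : ‖((expNegOne A : unitDiscMonoid A) : A)‖ = Real.exp (-1) := by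
  change ‖algebraMap ℝ A (Real.exp (-1))‖ = _
  rw [norm_algebraMap' A, Real.norm_eq_abs, abs_of_pos (Real.exp_pos _)]

variable (A) in
/-- The distinguished element of `Ψ^R_cns = Ψ_cns/Ψ_cns^×` at an archimedean place: the class of the elements of
absolute value `e⁻¹` ([IUTchII] Prop 4.4 (ii) p. 130 "determined by `p_v = e`"). [cite: Mochizuki2012, Prop 4.4 (ii) p.130] -/
def archDistinguishedClass : Associates (unitDiscMonoid A) := Associates.mk (expNegOne A)

/-- Every element of absolute value `e⁻¹` represents the distinguished class. [cite: Mochizuki2012, Prop 4.4 (ii) p.130] -/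
theorem mk_eq_archDistinguishedClass {z : unitDiscMonoid A} (hz : ‖(z : A)‖ = Real.exp (-1)) :
    Associates.mk z = archDistinguishedClass A :=
  Associates.mk_eq_mk_iff_associated.2 (associated_iff_norm_eq.2 (hz.trans norm_expNegOne.symm))

/-- **The isomorphism of Prop 4.3 (ii) matches the distinguished elements**: the class of norm `e⁻¹` ↦
`1 = log^{D^⊢_v}(p_v)` (abc-iut-L6-t2's `LogRealDatum.arch.logp`; [IUTchII] Prop 4.4 (ii) p. 130 "to the distinguished
element of `Ψ^R_cns(†D^⊢_v)` determined by `log^{†D^⊢_v}(p_v)`"). [cite: Mochizuki2012, Prop 4.4 (ii) p.130] -/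
theorem archRealifiedIso_distinguished :
    archRealifiedIso A (archDistinguishedClass A) = Multiplicative.ofAdd LogRealDatum.arch.logp := by
  change negLogNorm (expNegOne A) = Multiplicative.ofAdd 1
  apply Multiplicative.toAdd.injective
  apply NNReal.eq
  rw [coe_toAdd_negLogNorm, norm_expNegOne, Real.log_exp, neg_neg]
  rfl

end Realified

/-! ### 3. Prop 4.4 (ii), realified part: the unique normalised isomorphism `Ψ^R_{†F^⊢_v} ⥲ R_{≥0}(†D^⊢_v)` -/

section Transport

variable {M N : Type*} [CommMonoid M] [CommMonoid N]

/-- `Ψ ↦ Ψ/Ψ^×` is functorial in isomorphisms of commutative monoids (transport of classes modulo units).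
[cite: Mochizuki2012, Prop 4.4 (ii) p.130] -/
def assocCongr (e : M ≃* N) : Associates M ≃* Associates N where
  toFun := Quotient.map e fun _ _ h => Associated.map e.toMonoidHom h
  invFun := Quotient.map e.symm fun _ _ h => Associated.map e.symm.toMonoidHom h
  left_inv x := Quotient.inductionOn x fun a => by
    change Associates.mk (e.symm (e a)) = Associates.mk a
    rw [e.symm_apply_apply]
  right_inv y := Quotient.inductionOn y fun b => by
    change Associates.mk (e (e.symm b)) = Associates.mk b
    rw [e.apply_symm_apply]
  map_mul' x y := Quotient.inductionOn₂ x y fun a b => by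
    change Associates.mk (e (a * b)) = Associates.mk (e a) * Associates.mk (e b)
    rw [map_mul, Associates.mk_mul_mk]

/-- `assocCongr e` on a class. [cite: Mochizuki2012, Prop 4.4 (ii) p.130] -/
@[simp] theorem assocCongr_mk (e : M ≃* N) (a : M) : assocCongr e (Associates.mk a) = Associates.mk (e a) := rfl

end Transport

section Frobenioid

variable {Kv : Type u} [NormedField Kv] [NormedAlgebra ℝ Kv] (X : ArchLocalFrobenioid.{u} Kv)

/-- The distinguished element of `Ψ^R_{†F^⊢_v} := Ψ_{†F^⊢_v}/Ψ^×_{†F^⊢_v}` (`Ψ_{†F^⊢_v} = 𝒪^▷(†C^⊢_v) = X.OC`) "determined by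
`p_v = e = 2.71828…`" ([IUTchII] Prop 4.4 (ii) p. 130): the class of the elements of `𝒪^▷(†C_v)` of absolute value
`e⁻¹` under abc-iut-L5-t2's natural isomorphism `𝒪^▷(C_v) ⥲ 𝒪^▷_{K_v}` (`isoOK`). [cite: Mochizuki2012, Prop 4.4 (ii) p.130] -/
def archDistinguished : Associates X.OC := Associates.mk (X.isoOK.symm (expNegOne Kv))

/-- Every element of `𝒪^▷(†C_v)` of absolute value `e⁻¹` represents the distinguished class of `Ψ^R_{†F^⊢_v}`.
[cite: Mochizuki2012, Prop 4.4 (ii) p.130] -/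
theorem mk_eq_archDistinguished {m : X.OC} (hm : ‖((X.isoOK m : unitDiscMonoid Kv) : Kv)‖ = Real.exp (-1)) :
    Associates.mk m = archDistinguished X := by
  apply (assocCongr X.isoOK).injective
  rw [archDistinguished, assocCongr_mk, assocCongr_mk, MulEquiv.apply_symm_apply]
  exact mk_eq_archDistinguishedClass hm

/-- **An isomorphism `Ψ^R_{†F^⊢_v} ⥲ R_{≥0}(†D^⊢_v) = ℝ_{≥0}` with the printed normalisation** (existence half of
[IUTchII] Prop 4.4 (ii), realified part, p. 130): transport classes along `𝒪^▷(C_v) ⥲ 𝒪^▷_{K_v}`, then `−log ‖·‖`.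
[cite: Mochizuki2012, Prop 4.4 (ii) p.130] -/
def realifiedIsoArch : Associates X.OC ≃* Multiplicative ℝ≥0 :=
  (assocCongr X.isoOK).trans (archRealifiedIso Kv)

/-- `realifiedIsoArch` carries the distinguished element (`p_v = e`) to `log^{†D^⊢_v}(p_v) = 1`.
[cite: Mochizuki2012, Prop 4.4 (ii) p.130] -/
theorem realifiedIsoArch_distinguished :
    realifiedIsoArch X (archDistinguished X) = Multiplicative.ofAdd LogRealDatum.arch.logp := by
  rw [realifiedIsoArch, MulEquiv.trans_apply, archDistinguished, assocCongr_mk, MulEquiv.apply_symm_apply]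
  exact archRealifiedIso_distinguished

/-- **[IUTchII] Prop 4.4 (ii), realified part, PROVED** (p. 130: "a unique isomorphism of monoids
`Ψ^R_{†F^⊢_v} := Ψ_{†F^⊢_v}/Ψ^×_{†F^⊢_v} ⥲ Ψ^R_cns(†D^⊢_v) := R_{≥0}(†D^⊢_v)` that maps the distinguished element of `Ψ^R_{†F^⊢_v}`
determined by `p_v = e` … to the distinguished element … determined by `log^{†D^⊢_v}(p_v)`"), for every instance
`X` of the [IUTchI] Ex 3.4 interface, with `R_{≥0}(†D^⊢_v) = ℝ_{≥0} ∋ log(p_v) = 1` (abc-iut-L6-t2's normalisation):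
existence `realifiedIsoArch`; uniqueness because an automorphism of `ℝ_{≥0}` fixing a nonzero element is
trivial (abc-iut-L6-t2's `PsiRlf.mulEquiv_nnreal_eq_refl`). [cite: Mochizuki2012, Prop 4.4 (ii) p.130] -/
theorem existsUnique_realifiedIso :
    ∃! ρ : Associates X.OC ≃* Multiplicative ℝ≥0,
      ρ (archDistinguished X) = Multiplicative.ofAdd LogRealDatum.arch.logp := by
  refine ⟨realifiedIsoArch X, realifiedIsoArch_distinguished X, fun ρ hρ => ?_⟩
  have hfix : ((realifiedIsoArch X).symm.trans ρ) (Multiplicative.ofAdd LogRealDatum.arch.logp) =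
      Multiplicative.ofAdd LogRealDatum.arch.logp := by
    rw [MulEquiv.trans_apply, ← realifiedIsoArch_distinguished X, MulEquiv.symm_apply_apply, hρ,
      realifiedIsoArch_distinguished]
  have hid := PsiRlf.mulEquiv_nnreal_eq_refl ((realifiedIsoArch X).symm.trans ρ) LogRealDatum.arch.logp_pos
    hfix
  ext x
  have hx := MulEquiv.congr_fun hid (realifiedIsoArch X x)
  simp only [MulEquiv.trans_apply, MulEquiv.symm_apply_apply, MulEquiv.refl_apply] at hx
  rw [hx]

/-- The printed "natural poly-isomorphism … `Ψ^ss_{†F^⊢_v} ⥲ Ψ^ss_cns(†D^⊢_v)` … compatible with the natural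
splittings" (p. 130) has, on the realified factor, exactly this unique component: any isomorphism with the
printed normalisation IS `realifiedIsoArch`. [cite: Mochizuki2012, Prop 4.4 (ii) p.130] -/
theorem eq_realifiedIsoArch (ρ : Associates X.OC ≃* Multiplicative ℝ≥0)
    (hρ : ρ (archDistinguished X) = Multiplicative.ofAdd LogRealDatum.arch.logp) : ρ = realifiedIsoArch X :=
  (existsUnique_realifiedIso X).unique hρ (realifiedIsoArch_distinguished X)

/-- The same uniqueness through `Ψ_cns(†U_v)`: the composite `Ψ^R_{†F^⊢_v} ⥲ Ψ^R_cns(†D^⊢_v) ⥲ R_{≥0}(†D^⊢_v)` of the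
transport along ANY isomorphism of monoids `𝒪^▷(†C_v) ⥲ 𝒪^▷_{𝒜_{D_v}}` (e.g. the Kummer isomorphism of Prop 4.4 (i),
p416766's `kummerIsoArch`) with the isomorphism of Prop 4.3 (ii) for `𝒜_{D_v}` equals `realifiedIsoArch` as soon
as it respects the distinguished elements. [cite: Mochizuki2012, Prop 4.4 (ii) p.130] -/
theorem assocCongr_trans_archRealifiedIso_eq (φ : X.OC ≃* unitDiscMonoid X.Afield)
    (hφ : ((assocCongr φ).trans (archRealifiedIso X.Afield)) (archDistinguished X) =
      Multiplicative.ofAdd LogRealDatum.arch.logp) :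
    (assocCongr φ).trans (archRealifiedIso X.Afield) = realifiedIsoArch X :=
  eq_realifiedIsoArch X _ hφ

end Frobenioid

end GoodPrimeKummer

end Literature.IUT.HodgeArakelov

end
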